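import Mathlib
import HarnessLib
import Summits.ValiantsHypothesis.ValiantsHypothesis.Theses.MonotoneRestoration
import Literature.Computability.AlgebraicComplexity.SymmetricCircuitSubstitution

/-! # Route MonotoneRestoration — crux `MonotoneRestorationQP`, line Sketch v10, stub Z1
(stmt-ValiantsHypothesis-15886)

**Substitution (composition) of symmetric circuits** — the hub of THEOREM ζ (the size calculus of
square-symmetric circuits). If a `Γ`-symmetric Dawar–Wilsenach labelled circuit `C₁` over the
variables `X` computes a family `(g_{x'})_{x' ∈ X'}` at outputs indexed by a `Γ`-set `X'`, and a
`Γ`-symmetric circuit `C₂` over the VARIABLES `X'` computes `(h_y)_{y ∈ Y}`, then the substituted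
family `(h_y(x' ↦ g_{x'}))_y` (`MvPolynomial.aeval`) is computed by a `Γ`-symmetric circuit over
`X` on at most `|G₁| + |G₂|` gates.

Proof: the universe-`0` instance of the tree lemma
`LabelledArithCircuit.IsSymmetric.exists_substitution`
(`Literature/Computability/AlgebraicComplexity/SymmetricCircuitSubstitution.lean`, p161502): gate set
`G₁ ⊕ G₂`, a variable gate `x'` of `C₂` becomes a unary `+` gate over the output gate `x'` of `C₁`,
a constant gate of `C₂` whose constant already labels a gate of `C₁` becomes a unary `+` gate over
that source, automorphism pairs act as `π₁ ⊕ π₂`.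
-/

noncomputable section

-- `Summit.ValiantsHypothesis.ValiantsHypothesis.…` is the tree's mandated namespace (Sub = Summit).
set_option linter.dupNamespace false

namespace Summit.ValiantsHypothesis.ValiantsHypothesis.Theorems

open Literature.Computability.AlgebraicComplexity

/-- **Z1 — substitution (composition) of symmetric circuits** (crux `MonotoneRestorationQP`, line
Sketch v10; registered stub `stub_symmetric_substitution`): a `Γ`-symmetric circuit `C₂` over the
variables `X'` composed after a `Γ`-symmetric circuit `C₁` with outputs indexed by `X'` gives a
`Γ`-symmetric circuit over `X` computing the substituted outputs, on at most `|G₁| + |G₂|` gates.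
Instance of `LabelledArithCircuit.IsSymmetric.exists_substitution`. -/
theorem stub_symmetric_substitution {K X X' Y Γ G₁ G₂ : Type} [CommSemiring K] [Group Γ]
    [MulAction Γ X] [MulAction Γ X'] [MulAction Γ Y] [Fintype G₁] [Fintype G₂]
    (C₁ : LabelledArithCircuit K X X' G₁) (C₂ : LabelledArithCircuit K X' Y G₂)
    (h₁ : C₁.IsSymmetric Γ) (h₂ : C₂.IsSymmetric Γ) :
    ∃ (G : Type) (_ : Fintype G) (C : LabelledArithCircuit K X Y G),
      C.IsSymmetric Γ ∧
      (∀ y, C.eval (C.output y) =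
        MvPolynomial.aeval (fun x' => C₁.eval (C₁.output x')) (C₂.eval (C₂.output y))) ∧
      Fintype.card G ≤ Fintype.card G₁ + Fintype.card G₂ :=
  h₁.exists_substitution h₂

end Summit.ValiantsHypothesis.ValiantsHypothesis.Theorems

end
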